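import Mathlib
import HarnessLib
import Summits.Ventures.LatticeQCDFlow.Exactness.JarzynskiKernel
import Summits.Ventures.LatticeQCDFlow.Exactness.FlowPushforward
import Summits.Ventures.LatticeQCDFlow.Exactness.AdjointKernels
import Summits.Ventures.LatticeQCDFlow.Exactness.NCMCGeneralSpace

/-!
# Crooks pairs, concretely: a stochastic step with its adjoint, a bijective layer with its Jacobian, and their concatenation

HONEST FRAMING: exact (Metropolis-corrected) sampling algorithms for lattice gauge theory;
figures of merit are autocorrelation/cost numbers at stated couplings and volumes; no
continuum-physics claim.

Venture `LatticeQCDFlow` (cell pub-lqcd), topic `Exactness`; FANOUT row 13 (`eng-snf`, GEN-9).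
NEW WORK of the cell (general measure theory, elementary), not a published result; nothing is
cited as a fact (Crooks 1998/2000, Neal 1996 "mutually reversible kernels", Wu–Köhler–Noé 2020 and
Caselle–Cellini–Nada–Panero 2022 "stochastic normalizing flows" named only).

`Exactness/NCMCGeneralSpace.lean` reduces the exactness of the Metropolized switch on a general
state space to ONE hypothesis on the protocol, `CrooksPair ν₀ ν₁ κF κR s e W` (Crooks' identity
as an equality of measures on evolution records).  THIS file discharges it for the two building
blocks of every `latflow-snf` protocol and closes it under concatenation, on a general measurable
`Ω` with measurable singletons (reference measure `vol`, Boltzmann weights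
`boltzmann vol S = e^{-S}·vol` of `Exactness/JarzynskiKernel.lean`):

* **`crooksPair_step`** — ONE STOCHASTIC STEP: switch the action `S₀ → S₁` at fixed configuration
  (work `S₁ x − S₀ x`, the engine's convention), then move with a Markov kernel `κ`; the reverse
  protocol moves with an ADJOINT `κadj` of `κ` for `e^{-S₁}·vol` — hypothesis
  `(e^{-S₁}vol ⊗ κadj)∘swap = e^{-S₁}vol ⊗ κ` (`Measure.compProd`) — and switches back.  Records
  are (start, end) pairs, `κF = id ×ₖ κ`, `κR = κadj ×ₖ id`.  `crooksPair_step_of_isAdjointPair` —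
  the same from row 9's `IsAdjointPair κ κadj (e^{-S₁}vol)` (`Exactness/AdjointKernels.lean`:
  a reversible update is its own adjoint, the REVERSED sweep is the adjoint of a sweep of
  reversible updates — `isAdjointPair_cycle_reverse` — and the SU(N) link update with reversed
  subgroup frames is the adjoint of the forward one — `cmLinkUpdate_reverse_isAdjointPair`), so
  the engine's `reverse=True` sweeps ARE the reverse protocol of a Crooks pair.
* **`crooksPair_layer`** — ONE DETERMINISTIC COUPLING LAYER: a measurable bijection `F` with exact
  Jacobian `J` for `vol` (`FlowPushforward.HasJacobian vol F J`, `F_*(J·vol) = vol`), charged the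
  work `S₁ (F x) − S₀ x − log J x` (the SNF "− log det" term); the reverse protocol applies `F⁻¹`.
  Records are start points, `κF = id`, `κR = δ_{F⁻¹}`.

* **`CrooksPair.comp`** — CONCATENATION: a Crooks pair from `ν₀` to `ν₁` (records `E₁`) followed
  by one from `ν₁` to `ν₂` (records `E₂`) is a Crooks pair from `ν₀` to `ν₂` on records `E₁ × E₂`
  (forward: the second protocol starts where the first ended, `compFwd = κF₁ ⊗ₖ (κF₂ ∘ e₁)`;
  reverse: the first reverse protocol starts where the second one ended, `compRev`; works add).
  The proof is two applications of Crooks' identity glued by Tonelli and the a.s. start / end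
  properties.

Iterating `CrooksPair.comp` along a protocol, every `latflow-snf` evolution — any interleaving of
heat-bath / over-relaxation sweeps (with their adjoints) and coupling layers (each with a
`HasJacobian` certificate for the reference measure — for stout layers on `SU(N)^E` with product
Haar measure this certificate is the HYPOTHESIS, as in `FlowPushforward.lean`) between the prior
and the target action — is a Crooks pair, so by `NCMCGeneralSpaceKernel.switchKernel_invariant` its
Metropolized switch (`correction = ncmc-metropolis`) is exact on the engine's state space; the
finite-space path-sum versions are `NCMCExpandedEnsemble.lean` / `NCMCExpandedEnsembleSNF.lean`.
No `n`-ary declaration is made: the binary concatenation is the inductive step.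
-/

namespace Summit.Ventures.LatticeQCDFlow.Exactness.GeneralNCMC

open MeasureTheory ProbabilityTheory Set
open scoped ENNReal

variable {Ω : Type*} [MeasurableSpace Ω]

/-! ## One stochastic step with its adjoint -/

section Step

variable [MeasurableSingletonClass Ω]

/-- **One stochastic protocol step is a Crooks pair.**  Prior weight `e^{-S₀}·vol`, target weight
`e^{-S₁}·vol`; forward: charge `S₁ x − S₀ x` at the current configuration `x`, then move `x → y`
with `κ`; reverse: from `y` move with the `e^{-S₁}·vol`-adjoint `κadj`, then switch back.  Records
`(x, y)`; the forward record kernel is `id ×ₖ κ`, the reverse one `κadj ×ₖ id`. -/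
theorem crooksPair_step {vol : Measure Ω} [SFinite vol] {S₀ S₁ : Ω → ℝ} (hS₀ : Measurable S₀)
    (hS₁ : Measurable S₁) (κ κadj : Kernel Ω Ω) [IsMarkovKernel κ] [IsMarkovKernel κadj]
    (hadj : (boltzmann vol S₁ ⊗ₘ κadj).map Prod.swap = boltzmann vol S₁ ⊗ₘ κ) :
    CrooksPair (boltzmann vol S₀) (boltzmann vol S₁) (Kernel.id ×ₖ κ) (κadj ×ₖ Kernel.id)
      Prod.fst Prod.snd (fun ε => S₁ ε.1 - S₀ ε.1) where
  measurable_s := measurable_fst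
  measurable_e := measurable_snd
  measurable_W := (hS₁.comp measurable_fst).sub (hS₀.comp measurable_fst)
  start_ae x := by
    rw [Kernel.prod_apply, Kernel.id_apply, Measure.dirac_prod]
    exact (ae_map_iff measurable_prodMk_left.aemeasurable
      (measurable_fst (measurableSet_singleton x))).2 (Filter.Eventually.of_forall fun _ => rfl)
  end_ae y := by
    rw [Kernel.prod_apply, Kernel.id_apply, Measure.prod_dirac]
    exact (ae_map_iff measurable_prodMk_right.aemeasurable
      (measurable_snd (measurableSet_singleton y))).2 (Filter.Eventually.of_forall fun _ => rfl)
  crooks := by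
    haveI : SFinite (boltzmann vol S₀) := by unfold boltzmann; infer_instance
    haveI : SFinite (boltzmann vol S₁) := by unfold boltzmann; infer_instance
    have hw : Measurable fun x : Ω => ENNReal.ofReal (Real.exp (-(S₁ x - S₀ x))) :=
      (Real.measurable_exp.comp (hS₁.sub hS₀).neg).ennreal_ofReal
    have hρ : Measurable fun ε : Ω × Ω => ENNReal.ofReal (Real.exp (-(S₁ ε.1 - S₀ ε.1))) :=
      hw.comp measurable_fst
    refine Measure.ext_of_lintegral _ fun f hf => ?_
    have hin : Measurable fun x => ∫⁻ y, f (x, y) ∂(κ x) := hf.lintegral_kernel_prod_right'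
    calc ∫⁻ ε, f ε ∂((boltzmann vol S₀).bind ⇑(Kernel.id ×ₖ κ)).withDensity
            (fun ε => ENNReal.ofReal (Real.exp (-(S₁ ε.1 - S₀ ε.1))))
        = ∫⁻ x, ∫⁻ ε, ((fun ε : Ω × Ω => ENNReal.ofReal (Real.exp (-(S₁ ε.1 - S₀ ε.1)))) * f) ε
            ∂((Kernel.id ×ₖ κ) x) ∂(boltzmann vol S₀) := by
          rw [lintegral_withDensity_eq_lintegral_mul _ hρ hf,
            Measure.lintegral_bind (Kernel.aemeasurable _) (hρ.mul hf).aemeasurable]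
      _ = ∫⁻ x, ((fun x => ENNReal.ofReal (Real.exp (-(S₁ x - S₀ x)))) *
            fun x => ∫⁻ y, f (x, y) ∂(κ x)) x ∂(boltzmann vol S₀) := by
          refine lintegral_congr fun x => ?_
          rw [Kernel.prod_apply, Kernel.id_apply, Measure.dirac_prod,
            lintegral_map (hρ.mul hf) measurable_prodMk_left]
          simp only [Pi.mul_apply]
          have hfx : Measurable fun y => f (x, y) := hf.comp measurable_prodMk_left
          rw [lintegral_const_mul _ hfx]
      _ = ∫⁻ x, ∫⁻ y, f (x, y) ∂(κ x) ∂(boltzmann vol S₁) := by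
          rw [← lintegral_withDensity_eq_lintegral_mul _ hw hin,
            boltzmann_withDensity_work vol hS₀ hS₁]
      _ = ∫⁻ p, f p ∂(boltzmann vol S₁ ⊗ₘ κ) := (Measure.lintegral_compProd hf).symm
      _ = ∫⁻ p, f p.swap ∂(boltzmann vol S₁ ⊗ₘ κadj) := by
          rw [← hadj, lintegral_map hf measurable_swap]
      _ = ∫⁻ y, ∫⁻ x, f (x, y) ∂(κadj y) ∂(boltzmann vol S₁) :=
          Measure.lintegral_compProd (hf.comp measurable_swap)
      _ = ∫⁻ y, ∫⁻ ε, f ε ∂((κadj ×ₖ Kernel.id) y) ∂(boltzmann vol S₁) := by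
          refine lintegral_congr fun y => ?_
          rw [Kernel.prod_apply, Kernel.id_apply, Measure.prod_dirac,
            lintegral_map hf measurable_prodMk_right]
      _ = ∫⁻ ε, f ε ∂((boltzmann vol S₁).bind ⇑(κadj ×ₖ Kernel.id)) :=
          (Measure.lintegral_bind (Kernel.aemeasurable _) hf.aemeasurable).symm

/-- **The engine's form of the adjoint hypothesis.**  With a finite target weight `e^{-S₁}·vol`
(finite partition function) and row 9's `IsAdjointPair κ κadj (e^{-S₁}·vol)`
(`Exactness/AdjointKernels.lean`) — a reversible update and itself, a sweep of reversible link
updates and the reversed sweep (`isAdjointPair_cycle_reverse`), the SU(N) link update and the one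
with reversed subgroup frames (`cmLinkUpdate_reverse_isAdjointPair`) — one stochastic protocol step
is a Crooks pair. -/
theorem crooksPair_step_of_isAdjointPair {vol : Measure Ω} [SFinite vol] {S₀ S₁ : Ω → ℝ}
    (hS₀ : Measurable S₀) (hS₁ : Measurable S₁) (κ κadj : Kernel Ω Ω) [IsMarkovKernel κ]
    [IsMarkovKernel κadj] [IsFiniteMeasure (boltzmann vol S₁)]
    (hadj : IsAdjointPair κ κadj (boltzmann vol S₁)) :
    CrooksPair (boltzmann vol S₀) (boltzmann vol S₁) (Kernel.id ×ₖ κ) (κadj ×ₖ Kernel.id)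
      Prod.fst Prod.snd (fun ε => S₁ ε.1 - S₀ ε.1) :=
  crooksPair_step hS₀ hS₁ κ κadj hadj.compProd_swap

end Step

/-! ## One deterministic layer with its Jacobian -/

section Layer

variable [MeasurableSingletonClass Ω]

/-- **One bijective coupling layer with exact Jacobian is a Crooks pair.**  Prior weight
`e^{-S₀}·vol`, target weight `e^{-S₁}·vol`; forward: `x ↦ F x`, charged
`W x = S₁ (F x) − S₀ x − log J x` (change of action minus log-Jacobian — the SNF work of a
deterministic layer); reverse: `y ↦ F⁻¹ y`.  Records are start points: `κF = id`, `κR = δ_{F⁻¹}`,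
`s = id`, `e = F`.  Hypothesis: `HasJacobian vol F J` of `Exactness/FlowPushforward.lean` with a
positive real Jacobian `J`. -/
theorem crooksPair_layer {vol : Measure Ω} {S₀ S₁ : Ω → ℝ} (hS₀ : Measurable S₀)
    (hS₁ : Measurable S₁) (F : Ω ≃ᵐ Ω) {J : Ω → ℝ} (hJ : Measurable J) (hJpos : ∀ x, 0 < J x)
    (hF : HasJacobian vol F fun x => ENNReal.ofReal (J x)) :
    CrooksPair (boltzmann vol S₀) (boltzmann vol S₁) (Kernel.id : Kernel Ω Ω)
      (Kernel.deterministic F.symm F.symm.measurable) id F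
      (fun x => S₁ (F x) - S₀ x - Real.log (J x)) where
  measurable_s := measurable_id
  measurable_e := F.measurable
  measurable_W := ((hS₁.comp F.measurable).sub hS₀).sub (Real.measurable_log.comp hJ)
  start_ae x := by
    rw [Kernel.id_apply, ae_dirac_eq]
    exact Filter.eventually_pure.2 rfl
  end_ae y := by
    rw [Kernel.deterministic_apply, ae_dirac_eq]
    exact Filter.eventually_pure.2 (F.apply_symm_apply y)
  crooks := by
    have hexp₀ : Measurable fun x => ENNReal.ofReal (Real.exp (-S₀ x)) :=
      (Real.measurable_exp.comp hS₀.neg).ennreal_ofReal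
    have hq : Measurable fun y => ENNReal.ofReal (Real.exp (-S₁ y)) :=
      (Real.measurable_exp.comp hS₁.neg).ennreal_ofReal
    have hW : Measurable fun x => S₁ (F x) - S₀ x - Real.log (J x) :=
      ((hS₁.comp F.measurable).sub hS₀).sub (Real.measurable_log.comp hJ)
    have hρ : Measurable fun x => ENNReal.ofReal (Real.exp (-(S₁ (F x) - S₀ x - Real.log (J x)))) :=
      (Real.measurable_exp.comp hW.neg).ennreal_ofReal
    -- left: `e^{-W} · (e^{-S₀} vol ∘ id) = (e^{-S₁} ∘ F) · J · vol`
    have hL : ((boltzmann vol S₀).bind ⇑(Kernel.id : Kernel Ω Ω)).withDensity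
          (fun x => ENNReal.ofReal (Real.exp (-(S₁ (F x) - S₀ x - Real.log (J x))))) =
        vol.withDensity fun x => ENNReal.ofReal (Real.exp (-S₁ (F x))) * ENNReal.ofReal (J x) := by
      rw [show (boltzmann vol S₀).bind ⇑(Kernel.id : Kernel Ω Ω) = boltzmann vol S₀ from
        Measure.id_comp, boltzmann, ← withDensity_mul _ hexp₀ hρ]
      congr 1
      funext x
      simp only [Pi.mul_apply]
      rw [← ENNReal.ofReal_mul (Real.exp_pos _).le, ← ENNReal.ofReal_mul (Real.exp_pos _).le,
        ← Real.exp_add, ← Real.exp_log (hJpos x), ← Real.exp_add, Real.log_exp]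
      congr 2
      ring
    -- right: `e^{-S₁} vol ∘ δ_{F⁻¹} = F⁻¹_* (e^{-S₁} vol)`
    have hR : (boltzmann vol S₁).bind ⇑(Kernel.deterministic F.symm F.symm.measurable) =
        (boltzmann vol S₁).map F.symm :=
      Measure.deterministic_comp_eq_map F.symm.measurable
    -- push the left side through `F`: the model-density theorem of `FlowPushforward`
    have hpush : Measure.map F
        (vol.withDensity fun x => ENNReal.ofReal (Real.exp (-S₁ (F x))) * ENNReal.ofReal (J x)) =
        boltzmann vol S₁ := by
      have h := hF.map_withDensity hq
      unfold boltzmann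
      exact h
    rw [hL, hR, ← hpush, MeasurableEquiv.map_symm_map]

end Layer


/-! ## Concatenation of Crooks pairs -/

section Comp

variable {E₁ E₂ : Type*} [MeasurableSpace E₁] [MeasurableSpace E₂]

/-- Forward record kernel of the CONCATENATED protocol: run the first protocol from `x`
(record `ε₁ ∼ κF₁ x`), then the second one from its end point (record `ε₂ ∼ κF₂ (e₁ ε₁)`). -/
noncomputable def compFwd (κF₁ : Kernel Ω E₁) (κF₂ : Kernel Ω E₂) (e₁ : E₁ → Ω)
    (he₁ : Measurable e₁) : Kernel Ω (E₁ × E₂) :=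
  κF₁ ⊗ₖ Kernel.prodMkLeft Ω (κF₂.comap e₁ he₁)

/-- Reverse record kernel of the concatenated protocol: run the second reverse protocol from `z`
(record `ε₂ ∼ κR₂ z`), then the first one from its start point (record `ε₁ ∼ κR₁ (s₂ ε₂)`); records
are stored in forward order `(ε₁, ε₂)`. -/
noncomputable def compRev (κR₁ : Kernel Ω E₁) (κR₂ : Kernel Ω E₂) (s₂ : E₂ → Ω)
    (hs₂ : Measurable s₂) : Kernel Ω (E₁ × E₂) :=
  Kernel.map (κR₂ ⊗ₖ Kernel.prodMkLeft Ω (κR₁.comap s₂ hs₂)) Prod.swap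

/-- The concatenated forward record kernel is Markov. -/
instance isMarkovKernel_compFwd (κF₁ : Kernel Ω E₁) (κF₂ : Kernel Ω E₂) [IsMarkovKernel κF₁]
    [IsMarkovKernel κF₂] (e₁ : E₁ → Ω) (he₁ : Measurable e₁) :
    IsMarkovKernel (compFwd κF₁ κF₂ e₁ he₁) := by
  unfold compFwd; infer_instance

/-- The concatenated reverse record kernel is Markov. -/
instance isMarkovKernel_compRev (κR₁ : Kernel Ω E₁) (κR₂ : Kernel Ω E₂) [IsMarkovKernel κR₁]
    [IsMarkovKernel κR₂] (s₂ : E₂ → Ω) (hs₂ : Measurable s₂) :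
    IsMarkovKernel (compRev κR₁ κR₂ s₂ hs₂) := by
  unfold compRev; exact Kernel.IsMarkovKernel.map _ measurable_swap

variable [MeasurableSingletonClass Ω]

/-- **Crooks pairs concatenate.**  If `(κF₁, κR₁, s₁, e₁, W₁)` is a Crooks pair from `ν₀` to `ν₁`
and `(κF₂, κR₂, s₂, e₂, W₂)` one from `ν₁` to `ν₂`, then running the two protocols in sequence
(forward: first then second from the end point reached; reverse: second then first), with the
works ADDED, is a Crooks pair from `ν₀` to `ν₂`.  By induction every `latflow-snf` protocol —
any interleaving of stochastic steps with their adjoints (`crooksPair_step`) and bijective layers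
with their Jacobians (`crooksPair_layer`) — is a Crooks pair, hence its Metropolized switch is
exact (`switchKernel_invariant`). -/
theorem CrooksPair.comp {ν₀ ν₁ ν₂ : Measure Ω} [SFinite ν₀] [SFinite ν₁] [SFinite ν₂]
    {κF₁ κR₁ : Kernel Ω E₁} {κF₂ κR₂ : Kernel Ω E₂} [IsMarkovKernel κF₁] [IsMarkovKernel κR₁]
    [IsMarkovKernel κF₂] [IsMarkovKernel κR₂] {s₁ e₁ : E₁ → Ω} {s₂ e₂ : E₂ → Ω} {W₁ : E₁ → ℝ}
    {W₂ : E₂ → ℝ} (h₁ : CrooksPair ν₀ ν₁ κF₁ κR₁ s₁ e₁ W₁)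
    (h₂ : CrooksPair ν₁ ν₂ κF₂ κR₂ s₂ e₂ W₂) :
    CrooksPair ν₀ ν₂ (compFwd κF₁ κF₂ e₁ h₁.measurable_e) (compRev κR₁ κR₂ s₂ h₂.measurable_s)
      (fun ε => s₁ ε.1) (fun ε => e₂ ε.2) (fun ε => W₁ ε.1 + W₂ ε.2) where
  measurable_s := h₁.measurable_s.comp measurable_fst
  measurable_e := h₂.measurable_e.comp measurable_snd
  measurable_W := (h₁.measurable_W.comp measurable_fst).add (h₂.measurable_W.comp measurable_snd)
  start_ae x := by
    rw [compFwd]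
    refine Kernel.ae_compProd_of_ae_ae
      ((h₁.measurable_s.comp measurable_fst) (measurableSet_singleton x)) ?_
    exact (h₁.start_ae x).mono fun ε₁ hε₁ => ae_of_all _ fun _ => hε₁
  end_ae z := by
    rw [compRev, Kernel.map_apply _ measurable_swap]
    refine (ae_map_iff measurable_swap.aemeasurable
      ((h₂.measurable_e.comp measurable_snd) (measurableSet_singleton z))).2 ?_
    refine Kernel.ae_compProd_of_ae_ae
      ((h₂.measurable_e.comp (measurable_snd.comp measurable_swap)) (measurableSet_singleton z)) ?_
    exact (h₂.end_ae z).mono fun ε₂ hε₂ => ae_of_all _ fun _ => hε₂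
  crooks := by
    -- names and measurability
    have hs₂ := h₂.measurable_s
    have he₁ := h₁.measurable_e
    set ρ₁ : E₁ → ℝ≥0∞ := fun ε₁ => ENNReal.ofReal (Real.exp (-W₁ ε₁)) with hρ₁def
    set ρ₂ : E₂ → ℝ≥0∞ := fun ε₂ => ENNReal.ofReal (Real.exp (-W₂ ε₂)) with hρ₂def
    have hρ₁ : Measurable ρ₁ := (Real.measurable_exp.comp h₁.measurable_W.neg).ennreal_ofReal
    have hρ₂ : Measurable ρ₂ := (Real.measurable_exp.comp h₂.measurable_W.neg).ennreal_ofReal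
    have hρ : (fun ε : E₁ × E₂ => ENNReal.ofReal (Real.exp (-(W₁ ε.1 + W₂ ε.2)))) =
        fun ε => ρ₁ ε.1 * ρ₂ ε.2 := by
      funext ε
      simp only [hρ₁def, hρ₂def]
      rw [← ENNReal.ofReal_mul (Real.exp_pos _).le, ← Real.exp_add]
      congr 2
      ring
    refine Measure.ext_of_lintegral _ fun f hf => ?_
    have hρm : Measurable fun ε : E₁ × E₂ => ρ₁ ε.1 * ρ₂ ε.2 :=
      (hρ₁.comp measurable_fst).mul (hρ₂.comp measurable_snd)
    -- `g (ε₁, ε₂) = ρ₂ ε₂ f (ε₁, ε₂)` and its two partial integrals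
    have hg : Measurable fun ε : E₁ × E₂ => ρ₂ ε.2 * f ε := (hρ₂.comp measurable_snd).mul hf
    -- G ε₁ = ∫ ρ₂ f (ε₁, ·) d κF₂ (e₁ ε₁)
    have hG : Measurable fun ε₁ => ∫⁻ ε₂, ρ₂ ε₂ * f (ε₁, ε₂) ∂((κF₂.comap e₁ he₁) ε₁) :=
      hg.lintegral_kernel_prod_right'
    -- H (y, ε₂) = ∫ f (·, ε₂) d κR₁ y, jointly measurable
    have hH : Measurable fun p : Ω × E₂ => ∫⁻ ε₁, f (ε₁, p.2) ∂((Kernel.prodMkRight E₂ κR₁) p) :=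
      (hf.comp (measurable_snd.prodMk (measurable_snd.comp measurable_fst))).lintegral_kernel_prod_right'
    have hHs : Measurable fun ε₂ => ∫⁻ ε₁, f (ε₁, ε₂) ∂(κR₁ (s₂ ε₂)) :=
      hH.comp (hs₂.prodMk measurable_id)
    have hm1 : Measurable fun ε : E₁ × E₂ => ρ₁ ε.1 * ρ₂ ε.2 * f ε := hρm.mul hf
    have hfs : Measurable fun p : E₂ × E₁ => f p.swap := hf.comp measurable_swap
    calc ∫⁻ ε, f ε ∂((ν₀.bind ⇑(compFwd κF₁ κF₂ e₁ he₁)).withDensity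
            fun ε => ENNReal.ofReal (Real.exp (-(W₁ ε.1 + W₂ ε.2))))
        -- unfold the forward side down to the first record
        = ∫⁻ x, ∫⁻ ε, ρ₁ ε.1 * ρ₂ ε.2 * f ε ∂(compFwd κF₁ κF₂ e₁ he₁ x) ∂ν₀ := by
          rw [hρ, lintegral_withDensity_eq_lintegral_mul _ hρm hf]
          simp only [Pi.mul_apply]
          rw [Measure.lintegral_bind (Kernel.aemeasurable _) hm1.aemeasurable]
      _ = ∫⁻ x, ∫⁻ ε₁, ρ₁ ε₁ * ∫⁻ ε₂, ρ₂ ε₂ * f (ε₁, ε₂) ∂((κF₂.comap e₁ he₁) ε₁) ∂(κF₁ x) ∂ν₀ := by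
          refine lintegral_congr fun x => ?_
          rw [compFwd, Kernel.lintegral_compProd _ _ _ hm1]
          refine lintegral_congr fun ε₁ => ?_
          have hgx : Measurable fun ε₂ => ρ₂ ε₂ * f (ε₁, ε₂) := hg.comp measurable_prodMk_left
          rw [← lintegral_const_mul _ hgx]
          dsimp only
          refine lintegral_congr fun ε₂ => ?_
          ring
      _ = ∫⁻ ε₁, ρ₁ ε₁ * ∫⁻ ε₂, ρ₂ ε₂ * f (ε₁, ε₂) ∂((κF₂.comap e₁ he₁) ε₁) ∂(ν₀.bind κF₁) :=
          (Measure.lintegral_bind (Kernel.aemeasurable _) (hρ₁.mul hG).aemeasurable).symm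
      _ = ∫⁻ ε₁, ∫⁻ ε₂, ρ₂ ε₂ * f (ε₁, ε₂) ∂((κF₂.comap e₁ he₁) ε₁)
            ∂((ν₀.bind κF₁).withDensity ρ₁) :=
          (lintegral_withDensity_eq_lintegral_mul _ hρ₁ hG).symm
      -- Crooks for the first pair
      _ = ∫⁻ y, ∫⁻ ε₁, ∫⁻ ε₂, ρ₂ ε₂ * f (ε₁, ε₂) ∂((κF₂.comap e₁ he₁) ε₁) ∂(κR₁ y) ∂ν₁ := by
          rw [hρ₁def, h₁.crooks, Measure.lintegral_bind (Kernel.aemeasurable _) hG.aemeasurable]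
      -- the first reverse record ends at `y`: the second protocol starts from `y`
      _ = ∫⁻ y, ∫⁻ ε₁, ∫⁻ ε₂, ρ₂ ε₂ * f (ε₁, ε₂) ∂(κF₂ y) ∂(κR₁ y) ∂ν₁ := by
          refine lintegral_congr fun y => lintegral_congr_ae ((h₁.end_ae y).mono fun ε₁ hε₁ => ?_)
          change ∫⁻ ε₂, ρ₂ ε₂ * f (ε₁, ε₂) ∂(κF₂ (e₁ ε₁)) = _
          rw [hε₁]
      -- Tonelli
      _ = ∫⁻ y, ∫⁻ ε₂, ρ₂ ε₂ * ∫⁻ ε₁, f (ε₁, ε₂) ∂(κR₁ y) ∂(κF₂ y) ∂ν₁ := by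
          refine lintegral_congr fun y => ?_
          rw [lintegral_lintegral_swap hg.aemeasurable]
          refine lintegral_congr fun ε₂ => ?_
          have hfx : Measurable fun ε₁ => f (ε₁, ε₂) := hf.comp (measurable_id.prodMk measurable_const)
          rw [← lintegral_const_mul _ hfx]
      -- the second forward record starts at `y`
      _ = ∫⁻ y, ∫⁻ ε₂, ρ₂ ε₂ * ∫⁻ ε₁, f (ε₁, ε₂) ∂(κR₁ (s₂ ε₂)) ∂(κF₂ y) ∂ν₁ := by
          refine lintegral_congr fun y => lintegral_congr_ae ((h₂.start_ae y).mono fun ε₂ hε₂ => ?_)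
          change _ = ρ₂ ε₂ * ∫⁻ ε₁, f (ε₁, ε₂) ∂(κR₁ (s₂ ε₂))
          rw [hε₂]
      _ = ∫⁻ ε₂, ρ₂ ε₂ * ∫⁻ ε₁, f (ε₁, ε₂) ∂(κR₁ (s₂ ε₂)) ∂(ν₁.bind κF₂) :=
          (Measure.lintegral_bind (Kernel.aemeasurable _) (hρ₂.mul hHs).aemeasurable).symm
      _ = ∫⁻ ε₂, ∫⁻ ε₁, f (ε₁, ε₂) ∂(κR₁ (s₂ ε₂)) ∂((ν₁.bind κF₂).withDensity ρ₂) :=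
          (lintegral_withDensity_eq_lintegral_mul _ hρ₂ hHs).symm
      -- Crooks for the second pair
      _ = ∫⁻ z, ∫⁻ ε₂, ∫⁻ ε₁, f (ε₁, ε₂) ∂(κR₁ (s₂ ε₂)) ∂(κR₂ z) ∂ν₂ := by
          rw [hρ₂def, h₂.crooks, Measure.lintegral_bind (Kernel.aemeasurable _) hHs.aemeasurable]
      -- reassemble the reverse side
      _ = ∫⁻ z, ∫⁻ ε, f ε ∂(compRev κR₁ κR₂ s₂ hs₂ z) ∂ν₂ := by
          refine lintegral_congr fun z => ?_
          rw [compRev, Kernel.map_apply _ measurable_swap, lintegral_map hf measurable_swap,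
            Kernel.lintegral_compProd _ _ _ hfs]
          rfl
      _ = ∫⁻ ε, f ε ∂(ν₂.bind ⇑(compRev κR₁ κR₂ s₂ hs₂)) :=
          (Measure.lintegral_bind (Kernel.aemeasurable _) hf.aemeasurable).symm

end Comp

end Summit.Ventures.LatticeQCDFlow.Exactness.GeneralNCMC
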